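import Mathlib
import HarnessLib
import Summits.Ventures.LatticeQCDFlow.Exactness.SU2MultiStepLeapfrogHMC
import Summits.Ventures.LatticeQCDFlow.Exactness.U1MultiStepLeapfrogHMC

/-!
# THE REVERSIBILITY TEST OF THE ENGINE'S LEAPFROG, TYPED: in exact arithmetic «integrate `n` steps, flip the momentum, integrate `n` steps, flip» returns EVERY phase-space point to itself, for EVERY force field — so the round-trip energy violation is exactly `0` on both rungs

HONEST FRAMING: exact (Metropolis-corrected) sampling algorithms for lattice gauge theory;
figures of merit are autocorrelation/cost numbers at stated couplings and volumes; no
continuum-physics claim.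

Venture `LatticeQCDFlow` (cell pub-lqcd), topic `Exactness`; FANOUT row 14 (`eng-flowhmc`, engine
`latflow.fthmc`, family B; the row's test column «reversibility: |δH| round trip < 10⁻⁹»).  A COROLLARY file:
NEW WORK of the cell over row 9's kernels of record `SU2MultiStepLeapfrogHMC` / `SUNMultiStepLeapfrogHMC`
(`sunLeapfrogProposalN pauliCoordι … ε g n = flip ∘ (kick–drift–kick)ⁿ`, `involutive_sunLeapfrogProposalN`) and
`U1MultiStepLeapfrogHMC` (`u1LeapfrogProposalN`, `involutive_u1LeapfrogProposalN`), `SplittingIntegrator` (`flip`,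
`kick`, `drift`, `mulDrift`, `palindromicWord`); nothing is cited as a fact; no number.  The point typed here is what
the measured `10⁻⁹` is a floating-point shadow of: the reference value of the test is EXACTLY zero, for ANY momentum
increment `g` (the accuracy of the autodiff force is irrelevant to the test — it checks the composition
flip ∘ word ∘ flip ∘ word, nothing else), any step size, any number of steps, any action in the energy.

* **`su2Leapfrog_forward_flip_backward`** / **`u1Leapfrog_forward_flip_backward`** — the engine's procedure read
  literally: `flip (Wⁿ (flip (Wⁿ (q, p)))) = (q, p)` for the step `W = palindromicWord [kick g] (drift (mulDrift e_ε))`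
  (`SU(2)`: `e_ε = su2ExpDrift ε`; `U(1)`: `e_ε = u1ExpDrift ε`);
* **`su2LeapfrogProposalN_roundTrip_energy`** / **`u1LeapfrogProposalN_roundTrip_energy`** — hence for EVERY
  function `H` of phase space (in particular `H = S + κΣ‖p_l‖²` for any action `S`), the round-trip energy
  violation `H(Ψ_n(Ψ_n z)) − H(z)` is `0`;
* `su2LeapfrogProposalN_roundTrip_abs_energy_le` / `u1…` — so `|δH_roundtrip| ≤ δ` for every `δ ≥ 0`: the test's
  tolerance bounds floating-point roundoff only.

NOT CLAIMED: anything in floating point (the typed maps are exact real arithmetic); the size of the roundoff; that a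
given implementation composes the stages in this order (that is what the test checks).
-/

noncomputable section

namespace Summit.Ventures.LatticeQCDFlow.Exactness

open Function

/-! ## `SU(2)` rung -/

section SU2

variable {ι : Type*} (ε : ℝ) (g : (ι → Matrix.specialUnitaryGroup (Fin 2) ℂ) → ι → EuclideanSpace ℝ (Fin 3)) (n : ℕ)

/-- **FORWARD, FLIP, BACKWARD, FLIP IS THE IDENTITY** for the engine's `SU(2)` leapfrog word, every force field `g`,
every step size and number of steps. -/
theorem su2Leapfrog_forward_flip_backward (q : ι → Matrix.specialUnitaryGroup (Fin 2) ℂ) (p : ι → EuclideanSpace ℝ (Fin 3)) :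
    flip (((palindromicWord [kick g] (drift (mulDrift (su2ExpDrift ε)))) ^ n)
      (flip (((palindromicWord [kick g] (drift (mulDrift (su2ExpDrift ε)))) ^ n) (q, p)))) = (q, p) := by
  have h := involutive_sunLeapfrogProposalN pauliCoordι pauliCoordι_skew ε g n (q, p)
  rw [sunLeapfrogProposalN, sunExpDrift_pauliCoordι, Equiv.Perm.mul_apply, Equiv.Perm.mul_apply] at h
  exact h

/-- **THE ROUND-TRIP ENERGY VIOLATION IS EXACTLY ZERO**, for every phase-space function `H`. -/
theorem su2LeapfrogProposalN_roundTrip_energy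
    (H : (ι → Matrix.specialUnitaryGroup (Fin 2) ℂ) × (ι → EuclideanSpace ℝ (Fin 3)) → ℝ)
    (z : (ι → Matrix.specialUnitaryGroup (Fin 2) ℂ) × (ι → EuclideanSpace ℝ (Fin 3))) :
    H (sunLeapfrogProposalN pauliCoordι pauliCoordι_skew ε g n (sunLeapfrogProposalN pauliCoordι pauliCoordι_skew ε g n z)) - H z = 0 := by
  rw [involutive_sunLeapfrogProposalN pauliCoordι pauliCoordι_skew ε g n z, sub_self]

/-- Hence the reversibility test passes at EVERY tolerance `δ ≥ 0` in exact arithmetic: with `H = S + κΣ‖p_l‖²`,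
`|H(Ψ_n(Ψ_n(q,p))) − H(q,p)| ≤ δ`. -/
theorem su2LeapfrogProposalN_roundTrip_abs_energy_le [Fintype ι] (S : (ι → Matrix.specialUnitaryGroup (Fin 2) ℂ) → ℝ) (κ : ℝ)
    {δ : ℝ} (hδ : 0 ≤ δ) (z : (ι → Matrix.specialUnitaryGroup (Fin 2) ℂ) × (ι → EuclideanSpace ℝ (Fin 3))) :
    |(S (sunLeapfrogProposalN pauliCoordι pauliCoordι_skew ε g n (sunLeapfrogProposalN pauliCoordι pauliCoordι_skew ε g n z)).1 +
        su2Kinetic κ (sunLeapfrogProposalN pauliCoordι pauliCoordι_skew ε g n (sunLeapfrogProposalN pauliCoordι pauliCoordι_skew ε g n z)).2) -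
      (S z.1 + su2Kinetic κ z.2)| ≤ δ := by
  rw [su2LeapfrogProposalN_roundTrip_energy ε g n (fun w => S w.1 + su2Kinetic κ w.2) z, abs_zero]
  exact hδ

end SU2

/-! ## `U(1)` rung -/

section U1

variable {ι : Type*} (ε : ℝ) (g : (ι → Circle) → ι → ℝ) (n : ℕ)

/-- **FORWARD, FLIP, BACKWARD, FLIP IS THE IDENTITY** for the engine's `U(1)` leapfrog word, every force field `g`. -/
theorem u1Leapfrog_forward_flip_backward (q : ι → Circle) (p : ι → ℝ) :
    flip (((palindromicWord [kick g] (drift (mulDrift (u1ExpDrift ε)))) ^ n)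
      (flip (((palindromicWord [kick g] (drift (mulDrift (u1ExpDrift ε)))) ^ n) (q, p)))) = (q, p) := by
  have h := involutive_u1LeapfrogProposalN (g := g) ε n (q, p)
  rw [u1LeapfrogProposalN, Equiv.Perm.mul_apply, Equiv.Perm.mul_apply] at h
  exact h

/-- **THE ROUND-TRIP ENERGY VIOLATION IS EXACTLY ZERO** on the `U(1)` rung, for every phase-space function `H`. -/
theorem u1LeapfrogProposalN_roundTrip_energy (H : (ι → Circle) × (ι → ℝ) → ℝ) (z : (ι → Circle) × (ι → ℝ)) :
    H (u1LeapfrogProposalN ε g n (u1LeapfrogProposalN ε g n z)) - H z = 0 := by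
  rw [involutive_u1LeapfrogProposalN (g := g) ε n z, sub_self]

/-- Hence the `U(1)` reversibility test passes at every tolerance `δ ≥ 0` in exact arithmetic (`H = S + κΣp_e²`). -/
theorem u1LeapfrogProposalN_roundTrip_abs_energy_le [Fintype ι] (S : (ι → Circle) → ℝ) (κ : ℝ) {δ : ℝ} (hδ : 0 ≤ δ)
    (z : (ι → Circle) × (ι → ℝ)) :
    |(S (u1LeapfrogProposalN ε g n (u1LeapfrogProposalN ε g n z)).1 + u1Kinetic κ (u1LeapfrogProposalN ε g n (u1LeapfrogProposalN ε g n z)).2) -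
      (S z.1 + u1Kinetic κ z.2)| ≤ δ := by
  rw [u1LeapfrogProposalN_roundTrip_energy ε g n (fun w => S w.1 + u1Kinetic κ w.2) z, abs_zero]
  exact hδ

end U1

end Summit.Ventures.LatticeQCDFlow.Exactness
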